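import Literature.Barriers.AtomisticToContinuum.HarmonicCrystalBallistic
import Literature.MathematicalPhysics.KineticTheory.HarmonicChainNESS
import Literature.MathematicalPhysics.KineticTheory.HarmonicChainFlux
import HarnessLib

/-!
# `HarmonicChainBallisticFlux` discharged: the harmonic chain conducts ballistically (proved)

`Literature/Barriers/AtomisticToContinuum/` (D-0021 barrier catalogue), companion of
`HarmonicCrystalBallistic.lean`: the named fact `HarmonicChainBallisticFlux` (Rieder–Lebowitz–Lieb
1967 / Nakazawa 1970, as restated in Bonetto–Lebowitz–Rey-Bellet 2000 §6.2, Roy–Dhar 2008 §2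
(2.8), Dhar 2008 §3.1) is PROVED, `theorem HarmonicChainBallisticFlux_holds`, by assembling

* `HarmonicChainCovariance.lean` — the stationary covariance `chainCov ω₂ γ N T_L T_R` (solution of
  the Lyapunov equation, positive definite; all bonds carry `fluxCoeff ω₂ γ N · (T_L - T_R)`);
* `LinearLangevinGaussian.lean`, `LinearLangevinGaussianMeasure.lean`, `HarmonicChainNESS.lean` —
  the Gaussian measure `harmonicNESS = Z⁻¹ e^{-½x♭ᵀC⁻¹x♭} dq dp` is a weak steady state
  (`∫ L f dμ = 0` by integration by parts and the Lyapunov equation) whose mean bond currents are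
  the position–momentum covariances;
* `HarmonicChainFlux.lean` — the closed form of `fluxCoeff` (explicit Nakazawa solution) and its
  limit `fluxCoeff ω₂ γ N → γr/(2(1+γ²)) > 0`.

Consequently the corollaries of `HarmonicCrystalBallistic.lean` hold unconditionally: Fourier's law
in the Bonetto–Lebowitz–Rey-Bellet form FAILS for `pinnedChain ω₂ 0 0 γ` (`not_fouriersLawFor`).

## References

* F. Bonetto, J. L. Lebowitz, L. Rey-Bellet, *Fourier's law: a challenge to theorists* (2000),
  §6.2, §7. [cite: BonettoLebowitzReyBellet2000, §6.2 and §7]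
* D. Roy, A. Dhar, J. Stat. Phys. 131 (2008), §2 eq. (2.8). [cite: RoyDhar2008, §2 eqs. (2.2) and (2.8)]
-/

noncomputable section

open MeasureTheory Filter Topology

namespace Literature.Barriers.AtomisticToContinuum

open Literature.MathematicalPhysics.KineticTheory.HeatConduction

/-- **`HarmonicChainBallisticFlux` holds** (Rieder–Lebowitz–Lieb 1967 / Nakazawa 1970): for the
pinned harmonic chain `pinnedChain ω₂ 0 0 γ` (`ω₂, γ > 0`) the flux coefficients
`c_N = fluxCoeff ω₂ γ N` converge to `c_∞ = γ r/(2(1+γ²)) > 0`, and for every `N` and all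
`T_L, T_R > 0` the Gaussian measure with covariance `chainCov ω₂ γ N T_L T_R` is a weak steady state
in which every bond carries the mean current `c_N (T_L - T_R)`.
[cite: BonettoLebowitzReyBellet2000, §6.2] -/
theorem HarmonicChainBallisticFlux_holds : HarmonicChainBallisticFlux := by
  intro ω₂ γ hω hγ
  refine ⟨fun N => fluxCoeff ω₂ γ N, fluxLimit ω₂ γ, fluxLimit_pos hω hγ, tendsto_fluxCoeff hω hγ,
    fun N T_L T_R hL hR => ?_⟩
  exact ⟨harmonicNESS ω₂ γ N T_L T_R, isSteadyState_harmonicNESS hω hγ N hL hR,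
    fun i hi => integral_bondCurrent_harmonicNESS_eq_fluxCoeff' hω hγ hL hR i hi⟩

/-- **Fourier's law fails for the pinned harmonic chain, unconditionally**: for all `ω₂, γ > 0`,
`¬ (pinnedChain ω₂ 0 0 γ).FouriersLawFor` (the finite-`N` response `D_N = (N-1) c_N → ∞`).
[Bonetto–Lebowitz–Rey-Bellet 2000, §7 ("the harmonic crystal, which does not satisfy Fourier's
law")] [cite: BonettoLebowitzReyBellet2000, §6.2 and §7] -/
theorem not_fouriersLawFor_harmonic {ω₂ γ : ℝ} (hω : 0 < ω₂) (hγ : 0 < γ) :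
    ¬ (pinnedChain ω₂ 0 0 γ).FouriersLawFor :=
  HarmonicChainBallisticFlux_holds.not_fouriersLawFor hω hγ

/-- **No proof of `FouriersLaw` can be insensitive to the anharmonic couplings**, unconditionally:
some member `pinnedChain ω₂ lam β γ` with `lam = β = 0` violates `FouriersLawFor`.
[cite: BonettoLebowitzReyBellet2000, §6.2] -/
theorem exists_not_fouriersLawFor_harmonic :
    ∃ ω₂ lam β γ : ℝ, 0 < ω₂ ∧ 0 ≤ lam ∧ 0 ≤ β ∧ 0 < γ ∧
      ¬ (pinnedChain ω₂ lam β γ).FouriersLawFor :=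
  HarmonicChainBallisticFlux_holds.exists_not_fouriersLawFor

end Literature.Barriers.AtomisticToContinuum
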